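import Summits.Ventures.Crystal3D.Theorems.StickyWulffConstantPolycrystalWulffBoundSuperTreeChimeraMeas
import Summits.Ventures.Crystal3D.Theorems.StickyWulffConstantPolycrystalWulffBoundSuperTreeNodes

/-!
# `PolycrystalWulffBound`, rung `rung_superTree_cells` — step 1: trimming and the trimmed chimera bound
# (line `PolyDensity`, crux `stmt-Ventures-19482`)

Route `StickyWulffConstant` of the venture `Summits/Ventures/Crystal3D`, second prover lane (poly-p2,
gen 13).  The rung for a TREE OF SUPER-GRAINS (next file) follows the script of the single-axis rung
(`rung_singleAxis_cells`, gen 10): trim, chimera lower bound, Minkowski content, `r → 0`.  This file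
isolates the two middle steps for the tree:
* `exists_superTree_trim` — inside every SLID node, remove from the cells of label `false` the points
  within `w_node`-distance `ρ` of a cell of label `true` of the same node.  Output: measurable sub-cells
  `Qt j ⊆ Q j`, pairwise disjoint, `w_node`-SEPARATED across different bodies inside each slid node, with
  `|⋃ Q| ≤ |⋃ Qt| + Σ_{trimmed pairs} |Q j ∩ (Q i + [−ρ, ρ]·w)|` (the wall charge, estimated per pair by
  `volume_lineTrimE3_le` in the rung).
* `superTree_trimmed_lower` — the chimera lower bound `|⋃ Qt|^{1/3} + r·32^{1/3} ≤ |C|^{1/3}` for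
  measurable `C ⊇ ⋃_j (Qt j + r·W(A j))` and such a trimmed family: `superTree_chimera_lower'` with the
  node hypothesis discharged by `superNode_bound_slide` on slid nodes (edge normals `⊥ w_node`) and by
  `superNode_bound_sameBody` on single-body nodes.
WHAT THIS IS NOT: the rung; the crux is not claimed.
-/

noncomputable section

open scoped BigOperators InnerProductSpace ENNReal Pointwise
open MeasureTheory Set

namespace Summit.Ventures.Crystal3D.Theorems

open Summit.Ventures.Crystal3D.Cruxes.TextureLiminf.TexShadow (E3)
open Literature.MathematicalPhysics.StatisticalMechanics (fccStacking barlowStacking IsHaggSeq)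

/-- **Trimming inside the slid nodes.**  Cells `Q j` (open, pairwise disjoint), node
map `nd`, slid flags, labels `τ` with «same node, same label ⇒ same body», slide directions `w f`, range
`ρ > 0`.  There are measurable `Qt j ⊆ Q j`, pairwise disjoint, such that inside every slid node two
sub-cells with different bodies are `w`-separated at range `ρ`, and the lost volume is at most the total
volume of the trimmed slabs `Q j ∩ (Q i + [−ρ,ρ]·w)` over the pairs `(i, j)` of one slid node with
`τ i = true`, `τ j = false`. -/
theorem exists_superTree_trim {k N : ℕ} (Q : Fin k → Set E3) (hQo : ∀ j, IsOpen (Q j))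
    (hdisj : ∀ j j', j ≠ j' → Disjoint (Q j) (Q j'))
    (Bd : Fin k → Set E3) (τ : Fin k → Bool) (nd : Fin k → Fin (N + 1)) (slid : Fin (N + 1) → Bool)
    (hτ : ∀ j j', nd j = nd j' → τ j = τ j' → Bd j = Bd j') (w : Fin (N + 1) → E3) (ρ : ℝ) :
    ∃ Qt : Fin k → Set E3, (∀ j, MeasurableSet (Qt j)) ∧ (∀ j, Qt j ⊆ Q j) ∧
      (∀ j j', j ≠ j' → Disjoint (Qt j) (Qt j')) ∧
      (∀ j j', nd j = nd j' → slid (nd j) = true → Bd j ≠ Bd j' →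
        ∀ x ∈ Qt j, ∀ t : ℝ, |t| ≤ ρ → x + t • w (nd j) ∉ Qt j') ∧
      volume (⋃ j, Q j) ≤ volume (⋃ j, Qt j) + ∑ j, ∑ i,
        (if (nd i = nd j ∧ slid (nd j) = true ∧ τ i = true ∧ τ j = false) then
          volume (Q j ∩ {x : E3 | ∃ s ∈ Icc (-ρ) ρ, x + s • w (nd j) ∈ Q i}) else 0) := by
  classical
  have hQm : ∀ j, MeasurableSet (Q j) := fun j => (hQo j).measurableSet
  set TP : Fin k → Fin k → Prop := fun i j =>
    nd i = nd j ∧ slid (nd j) = true ∧ τ i = true ∧ τ j = false with hTP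
  set Tr : Fin k → Fin k → Set E3 := fun i j =>
    if TP i j then Q j ∩ {x : E3 | ∃ s ∈ Icc (-ρ) ρ, x + s • w (nd j) ∈ Q i} else ∅ with hTr
  set Qt : Fin k → Set E3 := fun j => Q j \ ⋃ i, Tr i j with hQt
  have hQt' : ∀ j y, y ∈ Qt j ↔ y ∈ Q j ∧ y ∉ ⋃ i, Tr i j := fun j y => Iff.rfl
  have hslab_open : ∀ i j, IsOpen {x : E3 | ∃ s ∈ Icc (-ρ) ρ, x + s • w (nd j) ∈ Q i} := by
    intro i j
    have e : {x : E3 | ∃ s ∈ Icc (-ρ) ρ, x + s • w (nd j) ∈ Q i} =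
        ⋃ (s : ℝ) (_ : s ∈ Icc (-ρ) ρ), (fun x => x + s • w (nd j)) ⁻¹' Q i := by ext x; simp
    rw [e]
    exact isOpen_iUnion fun s => isOpen_iUnion fun _ =>
      (continuous_id.add continuous_const).isOpen_preimage _ (hQo i)
  have hTrm : ∀ i j, MeasurableSet (Tr i j) := by
    intro i j
    by_cases h : TP i j
    · simp only [hTr, if_pos h]; exact (hQm j).inter (hslab_open i j).measurableSet
    · simp only [hTr, if_neg h]; exact MeasurableSet.empty
  have hQtm : ∀ j, MeasurableSet (Qt j) := fun j =>
    (hQm j).diff (MeasurableSet.iUnion fun i => hTrm i j)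
  have hQtsub : ∀ j, Qt j ⊆ Q j := fun j y hy => ((hQt' j y).1 hy).1
  refine ⟨Qt, hQtm, hQtsub, fun j j' h => (hdisj j j' h).mono (hQtsub j) (hQtsub j'), ?_, ?_⟩
  · -- separation inside a slid node
    intro j j' hjj hsl hBd x hx t ht hxt
    have htI : t ∈ Icc (-ρ) ρ := ⟨by linarith [neg_abs_le t], (le_abs_self t).trans ht⟩
    have hτne : τ j ≠ τ j' := fun h => hBd (hτ j j' hjj h)
    cases hj : τ j <;> cases hj' : τ j'
    · exact hτne (hj.trans hj'.symm)
    · -- `j` false, `j'` true: `x` was trimmed from `Q j`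
      have hP : TP j' j := ⟨hjj.symm, hsl, hj', hj⟩
      have hmem : x ∈ Tr j' j := by
        simp only [hTr, if_pos hP]
        exact ⟨hQtsub j hx, t, htI, hQtsub j' hxt⟩
      exact ((hQt' j _).1 hx).2 (mem_iUnion.2 ⟨j', hmem⟩)
    · -- `j` true, `j'` false: `x + t w` was trimmed from `Q j'`
      have hP : TP j j' := ⟨hjj, by rw [← hjj]; exact hsl, hj, hj'⟩
      have hmem : x + t • w (nd j) ∈ Tr j j' := by
        simp only [hTr, if_pos hP]
        refine ⟨hQtsub j' hxt, -t, ⟨by linarith [htI.2], by linarith [htI.1]⟩, ?_⟩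
        rw [← hjj, add_assoc, ← add_smul, add_neg_cancel, zero_smul, add_zero]
        exact hQtsub j hx
      exact ((hQt' j' _).1 hxt).2 (mem_iUnion.2 ⟨j, hmem⟩)
    · exact hτne (hj.trans hj'.symm)
  · -- volume bookkeeping
    have hcover : (⋃ j, Q j) ⊆ (⋃ j, Qt j) ∪ ⋃ j, ⋃ i, Tr i j := by
      intro y hy
      obtain ⟨j, hyj⟩ := mem_iUnion.1 hy
      by_cases h : y ∈ ⋃ i, Tr i j
      · exact Or.inr (mem_iUnion.2 ⟨j, h⟩)
      · exact Or.inl (mem_iUnion.2 ⟨j, (hQt' j y).2 ⟨hyj, h⟩⟩)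
    have hTrvol : ∀ i j, volume (Tr i j) ≤
        (if (nd i = nd j ∧ slid (nd j) = true ∧ τ i = true ∧ τ j = false) then
          volume (Q j ∩ {x : E3 | ∃ s ∈ Icc (-ρ) ρ, x + s • w (nd j) ∈ Q i}) else 0) := by
      intro i j
      by_cases h : TP i j
      · simp only [hTr, if_pos h]
        rw [if_pos h]
      · simp only [hTr, if_neg h, measure_empty]
        rw [if_neg h]
    calc volume (⋃ j, Q j) ≤ volume ((⋃ j, Qt j) ∪ ⋃ j, ⋃ i, Tr i j) := measure_mono hcover
      _ ≤ volume (⋃ j, Qt j) + volume (⋃ j, ⋃ i, Tr i j) := measure_union_le _ _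
      _ ≤ volume (⋃ j, Qt j) + ∑ j, ∑ i, volume (Tr i j) := by
          gcongr
          refine (measure_iUnion_le _).trans ?_
          rw [tsum_fintype]
          refine Finset.sum_le_sum fun j _ => (measure_iUnion_le _).trans ?_
          rw [tsum_fintype]
      _ ≤ _ := by
          gcongr with j _ i _
          exact hTrvol i j

/-- **Trimmed chimera lower bound for a tree of super-grains.**  Cells `Q j` (open, bounded, pairwise
disjoint) with frames `A j`, labels `τ`, node map `nd`; the sorted-tree data and localized geometry of
`superTree_chimera_lower'` (edge normals `nrm`, thresholds `thr`, reference frames `Aref` with matching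
profiles, `δ`-separation); single-body nodes (`slid f = false`: every cell's body is `W(Aref f)`) and slid
nodes (`slid f = true`: cells co-axial with `Aref f` about `mS f`, bond/mirror `uS f`, slide direction
`wS f ⊥ mS f, uS f`, and every edge normal incident to `f` is `⊥ wS f`); a trimmed family `Qt j ⊆ Q j`
(measurable, pairwise disjoint, `wS`-separated across different bodies inside each slid node at range
`r·2/√6`, `0 < |⋃ Qt|`), `r·2(√5+1) ≤ δ`, and a measurable `C ⊇ ⋃_j (Qt j + r·W(A j))`.  Then
`|⋃ Qt|^{1/3} + r·32^{1/3} ≤ |C|^{1/3}`. -/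
theorem superTree_trimmed_lower {k N : ℕ} (Q : Fin k → Set E3) (hQb : ∀ j, Bornology.IsBounded (Q j))
    (A : Fin k → (E3 ≃ₗᵢ[ℝ] E3)) (nd : Fin k → Fin (N + 1))
    (par : Fin N → Fin (N + 1)) (hpar : ∀ i, (par i : ℕ) ≤ i) (nrm : Fin N → E3) (thr : Fin N → ℝ)
    (hn1 : ∀ i, ‖nrm i‖ = 1) (Aref : Fin (N + 1) → (E3 ≃ₗᵢ[ℝ] E3))
    (hprof : ∀ i (s : ℝ), volume ({y : E3 | ∀ ν : E3, ⟪y, ν⟫_ℝ ≤ Real.sqrt 2 / 4 *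
        ∑ᶠ w ∈ {w | w ∈ fccStacking 1 (Real.sqrt (2 / 3)) ∧ ‖w‖ = 1}, |⟪w, (Aref i.succ).symm ν⟫_ℝ|} ∩
        {y : E3 | s < ⟪y, nrm i⟫_ℝ}) =
      volume ({y : E3 | ∀ ν : E3, ⟪y, ν⟫_ℝ ≤ Real.sqrt 2 / 4 *
        ∑ᶠ w ∈ {w | w ∈ fccStacking 1 (Real.sqrt (2 / 3)) ∧ ‖w‖ = 1}, |⟪w, (Aref (par i)).symm ν⟫_ℝ|} ∩
        {y : E3 | s < ⟪y, nrm i⟫_ℝ}))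
    (hGt : ∀ i j, nd j = i.succ → ∀ x ∈ Q j, thr i < ⟪x, nrm i⟫_ℝ) {δ : ℝ}
    (hPt : ∀ i j, nd j = par i → ∀ x ∈ Q j,
      ⟪x, nrm i⟫_ℝ < thr i ∨ ∀ j', nd j' = i.succ → ∀ y ∈ Q j', δ ≤ dist x y)
    (hfar : ∀ j j', nd j ≠ nd j' → (∀ i, ¬ (nd j = par i ∧ nd j' = i.succ)) →
      (∀ i, ¬ (nd j' = par i ∧ nd j = i.succ)) → ∀ x ∈ Q j, ∀ y ∈ Q j', δ ≤ dist x y)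
    (slid : Fin (N + 1) → Bool) (mS uS wS : Fin (N + 1) → E3)
    (hN1 : ∀ j, slid (nd j) = false → {y : E3 | ∀ ν : E3, ⟪y, ν⟫_ℝ ≤ Real.sqrt 2 / 4 *
        ∑ᶠ w ∈ {w | w ∈ fccStacking 1 (Real.sqrt (2 / 3)) ∧ ‖w‖ = 1}, |⟪w, (A j).symm ν⟫_ℝ|} =
      {y : E3 | ∀ ν : E3, ⟪y, ν⟫_ℝ ≤ Real.sqrt 2 / 4 *
        ∑ᶠ w ∈ {w | w ∈ fccStacking 1 (Real.sqrt (2 / 3)) ∧ ‖w‖ = 1}, |⟪w, (Aref (nd j)).symm ν⟫_ℝ|})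
    (hN2 : ∀ j, slid (nd j) = true → ∃ (L : E3 ≃ₗᵢ[ℝ] E3) (s₁ s₂ : E3) (σ σ' : ℤ → ℤ),
      IsHaggSeq σ ∧ IsHaggSeq σ' ∧ L (EuclideanSpace.single (2 : Fin 3) (1 : ℝ)) = mS (nd j) ∧
      Aref (nd j) '' fccStacking 1 (Real.sqrt (2 / 3)) ⊆
        (fun q => L q + s₁) '' barlowStacking 1 (Real.sqrt (2 / 3)) σ ∧
      A j '' fccStacking 1 (Real.sqrt (2 / 3)) ⊆
        (fun q => L q + s₂) '' barlowStacking 1 (Real.sqrt (2 / 3)) σ')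
    (hu : ∀ f, slid f = true → ‖uS f‖ = 1) (hw : ∀ f, slid f = true → ‖wS f‖ = 1)
    (hum : ∀ f, slid f = true → ⟪uS f, mS f⟫_ℝ = 0) (hwm : ∀ f, slid f = true → ⟪wS f, mS f⟫_ℝ = 0)
    (hwu : ∀ f, slid f = true → ⟪wS f, uS f⟫_ℝ = 0)
    (hbond : ∀ f, slid f = true → uS f ∈ Aref f '' fccStacking 1 (Real.sqrt (2 / 3)))
    (hmir : ∀ f, slid f = true → (ℝ ∙ uS f)ᗮ.reflection '' (Aref f '' fccStacking 1 (Real.sqrt (2 / 3))) =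
      Aref f '' fccStacking 1 (Real.sqrt (2 / 3)))
    (hNa : ∀ i, slid (par i) = true → ⟪nrm i, wS (par i)⟫_ℝ = 0)
    (hNb : ∀ i, slid i.succ = true → ⟪nrm i, wS i.succ⟫_ℝ = 0)
    {r : ℝ} (hr : 0 < r) (hrδ : r * (2 * (Real.sqrt 5 + 1)) ≤ δ)
    (Qt : Fin k → Set E3) (hQtm : ∀ j, MeasurableSet (Qt j)) (hQtsub : ∀ j, Qt j ⊆ Q j)
    (hQtdisj : ∀ j j', j ≠ j' → Disjoint (Qt j) (Qt j'))
    (hsep : ∀ j j', nd j = nd j' → slid (nd j) = true →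
      {y : E3 | ∀ ν : E3, ⟪y, ν⟫_ℝ ≤ Real.sqrt 2 / 4 *
        ∑ᶠ w ∈ {w | w ∈ fccStacking 1 (Real.sqrt (2 / 3)) ∧ ‖w‖ = 1}, |⟪w, (A j).symm ν⟫_ℝ|} ≠
      {y : E3 | ∀ ν : E3, ⟪y, ν⟫_ℝ ≤ Real.sqrt 2 / 4 *
        ∑ᶠ w ∈ {w | w ∈ fccStacking 1 (Real.sqrt (2 / 3)) ∧ ‖w‖ = 1}, |⟪w, (A j').symm ν⟫_ℝ|} →
      ∀ x ∈ Qt j, ∀ t : ℝ, |t| ≤ r * (2 / Real.sqrt 6) → x + t • wS (nd j) ∉ Qt j')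
    (h0 : volume (⋃ j, Qt j) ≠ 0) {C : Set E3} (hC : MeasurableSet C)
    (hsub : ∀ j, ∀ x ∈ Qt j, ∀ y ∈ {y : E3 | ∀ ν : E3, ⟪y, ν⟫_ℝ ≤ Real.sqrt 2 / 4 *
        ∑ᶠ w ∈ {w | w ∈ fccStacking 1 (Real.sqrt (2 / 3)) ∧ ‖w‖ = 1}, |⟪w, (A j).symm ν⟫_ℝ|},
      x + r • y ∈ C) :
    volume (⋃ j, Qt j) ^ ((3 : ℕ)⁻¹ : ℝ) +
        ENNReal.ofReal r * (ENNReal.ofReal 32) ^ ((3 : ℕ)⁻¹ : ℝ) ≤ volume C ^ ((3 : ℕ)⁻¹ : ℝ) := by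
  classical
  have hvolQ : ∀ j, volume (Q j) < ⊤ := by
    intro j
    obtain ⟨R, hR⟩ := (hQb j).subset_closedBall 0
    exact lt_of_le_of_lt (measure_mono hR) measure_closedBall_lt_top
  have htop : volume (⋃ j, Qt j) ≠ ⊤ := by
    refine (lt_of_le_of_lt (measure_iUnion_le _) ?_).ne
    rw [tsum_fintype]
    exact ENNReal.sum_lt_top.2 fun j _ => lt_of_le_of_lt (measure_mono (hQtsub j)) (hvolQ j)
  have hnode_top : ∀ f : Fin (N + 1), volume (⋃ j, ⋃ (_ : nd j = f), Qt j) ≠ ⊤ := by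
    intro f
    refine (lt_of_le_of_lt (measure_mono ?_) htop.lt_top).ne
    exact iUnion_mono fun j => iUnion_subset fun _ => Subset.rfl
  refine superTree_chimera_lower' par hpar nrm thr hn1 Aref hprof nd Qt A hQtm hQtdisj
    (fun i j h x hx => hGt i j h x (hQtsub j hx))
    (fun i j h x hx => (hPt i j h x (hQtsub j hx)).imp_right
      fun h' j' hj' y hy => h' j' hj' y (hQtsub j' hy))
    (fun j j' h h1 h2 x hx y hy => hfar j j' h h1 h2 x (hQtsub j hx) y (hQtsub j' hy))
    h0 htop hr hrδ hC hsub fun f c C' hC' h0f hH0 hcont => ?_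
  cases hsf : slid f
  · -- single-body node
    exact superNode_bound_sameBody nd f Qt hQtm A (Aref f)
      (fun j hj => by have h := hN1 j (by rw [hj]; exact hsf); rwa [hj] at h) hr
      (measurableSet_sortWindow par f nrm c)
      h0f (hnode_top f) hH0 hC' hcont
  · -- slid node
    refine superNode_bound_slide nd f (mS f) (uS f) (wS f) (hu f hsf) (hw f hsf) (hum f hsf)
      (hwm f hsf) (hwu f hsf) (Aref f) (hbond f hsf) (hmir f hsf) Qt hQtm hQtdisj A
      (fun j hj => by have h := hN2 j (by rw [hj]; exact hsf); rwa [hj] at h) hr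
      (fun j j' hj hj' hne x hx t ht => by
        have h := hsep j j' (hj.trans hj'.symm) (by rw [hj]; exact hsf) hne x hx t ht
        rwa [hj] at h)
      (measurableSet_sortWindow par f nrm c)
      (sortWindow_add_smul_mem par f nrm c (wS f)
        (fun i hi => by have h := hNa i (by rw [hi]; exact hsf); rwa [hi] at h)
        (fun i hi => by have h := hNb i (by rw [← hi]; exact hsf); rwa [← hi] at h))
      h0f (hnode_top f) hH0 hC' hcont

end Summit.Ventures.Crystal3D.Theorems

end
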